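import Literature.NumberTheory.Rogawski1990.GlobalAPacketMembership              -- ★ `MemXiFamily`, `IsXiLocalFamily`, `LocalConstituentsIn`, `cmSplitPacket`, `Gqs`, `qsForm`
import Literature.NumberTheory.Rogawski1990.SupercuspidalNotSphericalCofinite    -- ★ `IrrClass.IsSupercuspidal.comap` (supercuspidality rides `comap`)
import Literature.NumberTheory.Automorphic.LocalUnitaryGroupCongrInner           -- ★ `cmDatumLocalCongr`, `coe_cmDatumLocalCongr_apply`, `formCongr_mul_eq`, `formCongr_smul_eq`
import Literature.NumberTheory.Automorphic.IrreducibleClassesComapInner          -- ★ `IrrClass.comap_comap`, `IrrClass.comap_eq_comap_of_forall_eq_conj` (+ ★ `comap_symm_comap`, `comap_isConstituentOf_comp_iff`)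
import Literature.NumberTheory.Automorphic.IrreducibleClassesConstituents        -- ★ `IrrClass.isConstituentOf_congr`
import HarnessLib

/-!
# R90-TF · S9 «InnerForm-13.3.6 (c)» — (B3b) LOCAL CONSTITUENTS AND `MemXiFamily` RIDE A CONGRUENCE OF HERMITIAN FORMS
# (Rogawski 1990 §14.2 pp. 232–234 «`G′_v` is isomorphic to `G_v` if `v` is finite … the equivalence classes of representations of `G_v` and `G′_v` are
# canonically identified»; Platonov–Rapinchuk 1994 §2.3)

Cell `hodgecm-mathlib`, crux H413 (`stmt-HodgeConjecture-24833`), route of record `HCCMUnconditional`; programme R90-TF (brief `director/R90-BRIEF.v2.md`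
1f40d54518340a35), section S9 = InnerForm-13.3.6 (c) (base `R90-IF`), seat R90-IF-p02 (g0), hand **p02 = (B3b) beneath `R90.S9.sock_S9_similitudeTransport`**
(tree FILE B `Cruxes/H413/Lines/R90_S9_InnerFormTransportB.lean` :197 `SocketSimilitudeTransport`, ED. 2 sub-socket census (B3a)∕(B3b)∕(B3c) in its docstring),
ROAD «LOCAL CONSTITUENTS + `MemXiFamily` RIDE THE CONGRUENCE» (EMIT S9 WAVE 1, R90 bus 2026-09-04T15:27:13Z).  Helper file, lane
`--supports stmt-HodgeConjecture-24833 --as helper`; theorems only (no definition, no instance, no notation, no named fact, no `sorry`).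
HONEST LABEL: HC_CM is proved only modulo the 7 printed citations (2 remaining named inputs: hLiu418 = stmt-HodgeConjecture-24832, h413 =
stmt-HodgeConjecture-24833) until rung 0 closes; this file proves no printed GLOBAL statement — it is the place-by-place TRANSPORT ALGEBRA of the ξ-envelope
★ `MemXiFamily` (D6, `Rogawski1990/GlobalAPacketMembership`) along local changes of basis, the piece of (B3) that is pure bookkeeping.

## Setting
`L` a CM field, `L⁺` its maximal real subfield, two hermitian `H₀, H′ ∈ M₃(L)` with unit determinants, and AT EVERY FINITE PLACE `v` of `L⁺` a LOCAL FORM CONGRUENCE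
`ᵗT̄_v · (H₀)_v · T_v = a_v • (H′)_v` (`T_v ∈ GL₃(L ⊗ L⁺_v)`, `a_v` a unit), i.e. the identification ★ `e_v := cmDatumLocalCongr L v T_v _ _ : U(H′)(L⁺_v) ≃ₜ* U(H₀)(L⁺_v)`,
`g ↦ T_v g T_v⁻¹` [§14.2 p. 232 «`G′_v` is isomorphic to `G_v` if `v` is finite»].  The motivating instance (B3): `H′ = H`, `H₀ = a • Φ₃`, `T_v = Q_v` the `v`-component
of ONE rational `Q ∈ GL₃(L)` with `ᵗQ̄ (a • Φ₃) Q = H` (★ `AdelicCongruenceLocalCompat.toLocal_adelicUnitaryGroupCongr`: the adelic congruence `x ↦ Q_𝔸 x Q_𝔸⁻¹` has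
`v`-component `e_v` with `a_v = 1`, ★ `formCongr_toLocalGL_one_smul`) — but nothing below uses rationality: the transport is local at each `v`.

## Contents (all proved; sizes S)
* §1 CONGRUENCE ALGEBRA (rank `N`, any three forms `A, B, C`): `formCongr_mul_eq_mul_smul_of_formCongr_eq_smul` (`ᵗ(T_vT)‾ A (T_vT) = (a_v a) • C` from the two
  one-step congruences), `cmDatumLocalCongr_trans_cmDatumLocalCongr` (the composite of two form-congruence identifications IS the identification of the
  product frame, as `ContinuousMulEquiv`s), and the two readings on classes ★ `IrrClass.comap` that (B3)'s assembler consumes: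
  `comap_symm_comap_symm_cmDatumLocalCongr` («`(x ∘ e_T⁻¹) ∘ e_v⁻¹ = x ∘ e_{T_vT}⁻¹`» — the packet label moves) and `comap_comap_symm_cmDatumLocalCongr_mul`
  («`(x ∘ e_{T_vT}⁻¹) ∘ e_v = x ∘ e_T⁻¹`» — the conclusion of (B0) `XiMembershipAt` moves back).
* §2 PACKETS: `cmSplitPacket_map_comap_cmDatumLocalCongr_symm` — at a split `v` (`w ∣ v`, `w̄ ≠ w`) the split packet `{i_G(ξ_w) ∘ (U(H′)_v ≅ GL₃(L_w))}` of `U(H′)` is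
  carried by `e_v` to the split packet of `U(H₀)` AT THE SAME `w` and labels: the two `w`-projections differ by the inner automorphism `Ad((T_v)_w⁻¹)` of `GL₃(L_w)`,
  which fixes classes (★ `IrrClass.comap_eq_comap_of_forall_eq_conj`) [§14.2 p. 234 «canonically identified»; §4.13 p. 62].
* §3 THE ENVELOPE RIDES: `localConstituentsIn_map_comap_symm` (for ANY identifications `e_v` and any two discrete `P₀` of `U(H₀)`, `P′` of `U(H′)` whose local
  constituents correspond — hypothesis `hloc`: every `v`-constituent `c` of `P₀` has `c ∘ e_v` a `v`-constituent of `P′` — a family serving `P′` serves `P₀` after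
  `e_v`-transport), `isXiLocalFamily_map_comap_cmDatumLocalCongr_symm` (a ξ-local family for `U(H′)` transported by form congruences is a ξ-local family for
  `U(H₀)`: split clause §2; non-split clause §1 + supercuspidality rides ★ `IrrClass.IsSupercuspidal.comap`; the `Gqs`-side data — the constituent `x` of
  `i_G(χ_ξ)`, hence Keys labels and square-integrability — are UNTOUCHED, they live on `U(Φ₃)(L⁺_v)`), and the headline
  **`memXiFamily_of_localCongr` : `MemXiFamily P′ hH′ hH′d μω hμu ξ → (hloc) → MemXiFamily P₀ hH₀ hH₀d μω hμu ξ`** = the (B3b) sub-socket `sock_S9_congrMemXiFamily`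
  of FILE B's census with its ONE honest input named: `hloc`, the local-constituent correspondence that (B3a) (`DiscreteAutomorphicRep` transport along ★
  `adelicUnitaryGroupCongr`, seat p01) must deliver.
* §4 THE JUNCTION WITH (B3a), constituent currency: `comap_isConstituentOf_iff_of_localEquiv` — if at each `v` the local representation of `P₀` is EQUIVALENT
  (★ Mathlib-style `Representation.Equiv`) to that of `P′` read through `localPiEquiv ∘ e_v⁻¹ ∘ localPiEquiv⁻¹`, then `hloc` holds AS AN IFF (both directions:
  (B3) needs «constituents of `P₀` pull back» for `MemXiFamily` and «constituents of `P′` push forward» to apply (B0) at `Φ₃`) — ★ `isConstituentOf_congr` +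
  ★ `comap_isConstituentOf_comp_iff`.
What is NOT here: (B3a) itself (the automorphic-quotient ∕ `L²` ∕ `DiscreteAutomorphicRep` transport, p01) and (B3c) (the signed `πˢ`-witness is transport-stable,
★ `R90.S9.πs_eq_of_charIdentityAtTestSigned`, p03); the orbital-measure ∕ transfer-factor ∕ `hQS`-package transport of (B0)'s remaining binders.

## References
* [Rogawski1990] J. D. Rogawski, *Automorphic Representations of Unitary Groups in Three Variables*, Ann. of Math. Stud. 123 (1990): §14.2 pp. 232–234 (inner forms,
  `G′_v ≅ G_v` at finite `v`, classes canonically identified), Lemma 3.5.3 (a) p. 28; §4.13 p. 62 (split places); §13.1 p. 199, §13.3 p. 201 (`Π(ξ) = ⊗ Π(ξ_v)`).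
* [PlatonovRapinchuk1994] V. Platonov, A. Rapinchuk, *Algebraic Groups and Number Theory* (1994), §2.3 (equivalent forms have conjugate unitary groups).
* [BushnellHenniart2006] C. J. Bushnell, G. Henniart, *The Local Langlands Conjecture for GL(2)* (2006), §1.1 (`Irr(G)`; transport of classes).
-/

set_option autoImplicit false
-- the mandated namespace repeats the single-problem summit's segment (`HodgeConjecture.HodgeConjecture`)
set_option linter.dupNamespace false

noncomputable section

open NumberField IsDedekindDomain MeasureTheory
open scoped Matrix MatrixGroups

open Literature.NumberTheory Literature.NumberTheory.Automorphic Literature.NumberTheory.Automorphic.UnitaryGroup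
open Literature.NumberTheory.Rogawski1990 Literature.NumberTheory.GaloisRepresentations

namespace Summit.HodgeConjecture.HodgeConjecture.R90.S9

/-! ## §1 Congruence algebra: composites of local form congruences, and their readings on `Irr` -/

section Algebra

variable (L : Type) [Field L] [NumberField L] [IsCMField L] {N : ℕ} {A B C : Matrix (Fin N) (Fin N) L}
  (v : HeightOneSpectrum (𝓞 ↥(maximalRealSubfield L))) (T Tv : GL (Fin N) (LocalRing L v)) {a av : LocalRing L v}

/-- **Composite similitude factor.**  From `ᵗT̄ · B_v · T = a • C_v` and `ᵗT̄_v · A_v · T_v = a_v • B_v` (congruences over `L ⊗ L⁺_v`):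
`ᵗ(T_v T)‾ · A_v · (T_v T) = (a_v a) • C_v` (★ `formCongr_mul_eq`, ★ `formCongr_smul_eq`) — the hypothesis of ★ `cmDatumLocalCongr L v (T_v * T) …`.
[cite: PlatonovRapinchuk1994, §2.3] -/
theorem formCongr_mul_eq_mul_smul_of_formCongr_eq_smul
    (h : formCongr (conjLocal L (IsCMField.complexConj L) v) T (B.map (algebraMap L (LocalRing L v))) =
      a • C.map (algebraMap L (LocalRing L v)))
    (hv : formCongr (conjLocal L (IsCMField.complexConj L) v) Tv (A.map (algebraMap L (LocalRing L v))) =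
      av • B.map (algebraMap L (LocalRing L v))) :
    formCongr (conjLocal L (IsCMField.complexConj L) v) (Tv * T) (A.map (algebraMap L (LocalRing L v))) =
      (av * a) • C.map (algebraMap L (LocalRing L v)) := by
  rw [formCongr_mul_eq, hv, formCongr_smul_eq, h, smul_smul]

/-- **The composite of two form-congruence identifications is the identification of the product frame**:
`(g ↦ T g T⁻¹ : U(C)_v ≃ U(B)_v)` followed by `(g ↦ T_v g T_v⁻¹ : U(B)_v ≃ U(A)_v)` is `g ↦ (T_vT) g (T_vT)⁻¹ : U(C)_v ≃ U(A)_v` — as `ContinuousMulEquiv`s on the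
carriers `(cmDatum L N ·).Local v` (the product-frame hypothesis `hvT` is kept as a binder, any proof being accepted, e.g. `formCongr_mul_eq_mul_smul_of_formCongr_eq_smul`).
[cite: PlatonovRapinchuk1994, §2.3] -/
theorem cmDatumLocalCongr_trans_cmDatumLocalCongr (ha : IsUnit a) (hav : IsUnit av)
    (h : formCongr (conjLocal L (IsCMField.complexConj L) v) T (B.map (algebraMap L (LocalRing L v))) =
      a • C.map (algebraMap L (LocalRing L v)))
    (hv : formCongr (conjLocal L (IsCMField.complexConj L) v) Tv (A.map (algebraMap L (LocalRing L v))) =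
      av • B.map (algebraMap L (LocalRing L v)))
    (hvT : formCongr (conjLocal L (IsCMField.complexConj L) v) (Tv * T) (A.map (algebraMap L (LocalRing L v))) =
      (av * a) • C.map (algebraMap L (LocalRing L v))) :
    (cmDatumLocalCongr L v T ha h).trans (cmDatumLocalCongr L v Tv hav hv) =
      cmDatumLocalCongr L v (Tv * T) (hav.mul ha) hvT := by
  refine ContinuousMulEquiv.ext fun g => Subtype.ext ?_
  change Tv * (T * g.val * T⁻¹) * Tv⁻¹ = (Tv * T) * g.val * (Tv * T)⁻¹
  rw [mul_inv_rev]
  simp only [mul_assoc]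

/-- **The packet LABEL moves: `(x ∘ e_T⁻¹) ∘ e_v⁻¹ = x ∘ e_{T_vT}⁻¹` on `Irr`.**  For a class `x` of `U(C)(L⁺_v)` (in D6: `C = Φ₃`, `x` a constituent of `i_G(χ_ξ)`),
pulling `comap e_T⁻¹ x ∈ Irr(U(B)_v)` back along `e_v⁻¹ : U(A)_v → U(B)_v` gives `comap e_{T_vT}⁻¹ x ∈ Irr(U(A)_v)` (★ `IrrClass.comap_comap`; the two identifications
`e_T⁻¹ ∘ e_v⁻¹` and `e_{T_vT}⁻¹` AGREE pointwise, `T⁻¹ (T_v⁻¹ g T_v) T = (T_vT)⁻¹ g (T_vT)`, so ★ `comap_eq_comap_of_forall_eq_conj` with `u = 1`).  The multiplier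
proof `hc` and the frame proof `hvT` are binders (any proofs accepted). [cite: Rogawski1990, §14.2 pp. 232–234] [cite: BushnellHenniart2006, §1.1] -/
theorem comap_symm_comap_symm_cmDatumLocalCongr (ha : IsUnit a) (hav : IsUnit av) (hc : IsUnit (av * a))
    (h : formCongr (conjLocal L (IsCMField.complexConj L) v) T (B.map (algebraMap L (LocalRing L v))) =
      a • C.map (algebraMap L (LocalRing L v)))
    (hv : formCongr (conjLocal L (IsCMField.complexConj L) v) Tv (A.map (algebraMap L (LocalRing L v))) =
      av • B.map (algebraMap L (LocalRing L v)))
    (hvT : formCongr (conjLocal L (IsCMField.complexConj L) v) (Tv * T) (A.map (algebraMap L (LocalRing L v))) =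
      (av * a) • C.map (algebraMap L (LocalRing L v)))
    (x : IrrClass ((cmDatum L N C).Local v)) :
    IrrClass.comap (cmDatumLocalCongr L v Tv hav hv).symm (IrrClass.comap (cmDatumLocalCongr L v T ha h).symm x) =
      IrrClass.comap (cmDatumLocalCongr L v (Tv * T) hc hvT).symm x := by
  rw [IrrClass.comap_comap]
  refine IrrClass.comap_eq_comap_of_forall_eq_conj _ _ 1 (fun g => ?_) x
  rw [one_mul, inv_one, mul_one]
  refine Subtype.ext ?_
  change (Tv * T)⁻¹ * g.val * (Tv * T) = T⁻¹ * (Tv⁻¹ * g.val * Tv) * T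
  rw [mul_inv_rev]
  simp only [mul_assoc]

/-- **The conclusion moves back: `(x ∘ e_{T_vT}⁻¹) ∘ e_v = x ∘ e_T⁻¹` on `Irr`.**  For a class `x` of `U(C)(L⁺_v)`, the class `comap e_{T_vT}⁻¹ x ∈ Irr(U(A)_v)` pulled
back along `e_v : U(B)_v → U(A)_v` is `comap e_T⁻¹ x ∈ Irr(U(B)_v)` — the shape in which a disjunct «`c₀ = πⁿ ∘ e₀⁻¹`» of (B0) `XiMembershipAt` at `(A, T_vT)` is read
back at `(B, T)` through `c = comap e_v c₀` (★ `IrrClass.comap_comap`, ★ `comap_eq_comap_of_forall_eq_conj` with `u = 1`).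
[cite: Rogawski1990, §14.2 pp. 232–234] [cite: BushnellHenniart2006, §1.1] -/
theorem comap_comap_symm_cmDatumLocalCongr_mul (ha : IsUnit a) (hav : IsUnit av) (hc : IsUnit (av * a))
    (h : formCongr (conjLocal L (IsCMField.complexConj L) v) T (B.map (algebraMap L (LocalRing L v))) =
      a • C.map (algebraMap L (LocalRing L v)))
    (hv : formCongr (conjLocal L (IsCMField.complexConj L) v) Tv (A.map (algebraMap L (LocalRing L v))) =
      av • B.map (algebraMap L (LocalRing L v)))
    (hvT : formCongr (conjLocal L (IsCMField.complexConj L) v) (Tv * T) (A.map (algebraMap L (LocalRing L v))) =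
      (av * a) • C.map (algebraMap L (LocalRing L v)))
    (x : IrrClass ((cmDatum L N C).Local v)) :
    IrrClass.comap (cmDatumLocalCongr L v Tv hav hv) (IrrClass.comap (cmDatumLocalCongr L v (Tv * T) hc hvT).symm x) =
      IrrClass.comap (cmDatumLocalCongr L v T ha h).symm x := by
  rw [IrrClass.comap_comap]
  refine IrrClass.comap_eq_comap_of_forall_eq_conj _ _ 1 (fun g => ?_) x
  rw [one_mul, inv_one, mul_one]
  refine Subtype.ext ?_
  change T⁻¹ * g.val * T = (Tv * T)⁻¹ * (Tv * g.val * Tv⁻¹) * (Tv * T)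
  rw [mul_inv_rev]
  simp only [mul_assoc, inv_mul_cancel_left]

end Algebra

/-! ## §2 Packets: the split packet at `w` rides a form congruence [§4.13 p. 62; §14.2 p. 234] -/

section Packets

variable (L : Type) [Field L] [NumberField L] [IsCMField L] {H₀ H' : Matrix (Fin 3) (Fin 3) L}

/-- **The split packet is carried to the split packet (same `w`, same labels).**  At a place `v` split in `L` (`w ∣ v`, `w̄ ≠ w`), for a local form congruence
`e_v = cmDatumLocalCongr L v T_v _ _ : U(H′)_v ≃ₜ* U(H₀)_v`, the image under `IrrClass.comap e_v⁻¹` of ★ `cmSplitPacket L H′ … v w hw ν₀ χ′` (single member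
`i_G(ξ_w) ∘ s′`, `s′ : U(H′)_v ≅ GL₃(L_w)` the `w`-projection ★ `cmSplitEquiv`) IS ★ `cmSplitPacket L H₀ … v w hw ν₀ χ′`: the identifications `s′ ∘ e_v⁻¹` and `s₀` of
`U(H₀)_v` with `GL₃(L_w)` differ by the INNER automorphism `Ad((T_v)_w⁻¹)` (`(T_v⁻¹ g T_v)_w = (T_v)_w⁻¹ g_w (T_v)_w`, ★ `localGLPiEquiv` is multiplicative), and inner
automorphisms fix classes (★ `IrrClass.comap_eq_comap_of_forall_eq_conj`) — «the equivalence classes of representations … are canonically identified».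
[cite: Rogawski1990, §14.2 p. 234; §4.13 p. 62; §13.3 p. 201] [cite: BushnellHenniart2006, §1.1] -/
theorem cmSplitPacket_map_comap_cmDatumLocalCongr_symm
    (hH₀ : (H₀.map (cmConjRingHom L))ᵀ = H₀) (hH₀d : IsUnit H₀.det)
    (hH' : (H'.map (cmConjRingHom L))ᵀ = H') (hH'd : IsUnit H'.det)
    (v : HeightOneSpectrum (𝓞 ↥(maximalRealSubfield L))) (Tv : GL (Fin 3) (LocalRing L v)) {av : LocalRing L v}
    (hav : IsUnit av)
    (hv : formCongr (conjLocal L (IsCMField.complexConj L) v) Tv (H₀.map (algebraMap L (LocalRing L v))) =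
      av • H'.map (algebraMap L (LocalRing L v)))
    (w : PlacesOver L v) (hw : IsCMField.complexConj L • w.1 ≠ w.1)
    (ν₀ χ' : (w.1.adicCompletion L)ˣ →* ℂˣ) (hν₀u : ∀ x, ‖((ν₀ x : ℂˣ) : ℂ)‖ = 1)
    (hν₀c : Continuous fun x => ((ν₀ x : ℂˣ) : ℂ)) (hχ'u : ∀ x, ‖((χ' x : ℂˣ) : ℂ)‖ = 1)
    (hχ'c : Continuous fun x => ((χ' x : ℂˣ) : ℂ)) :
    (cmSplitPacket L H' hH' hH'd v w hw ν₀ χ' hν₀u hν₀c hχ'u hχ'c).map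
        (IrrClass.comap (cmDatumLocalCongr L v Tv hav hv).symm) =
      cmSplitPacket L H₀ hH₀ hH₀d v w hw ν₀ χ' hν₀u hν₀c hχ'u hχ'c := by
  refine LocalAPacket.ext' ?_ rfl
  change IrrClass.comap (cmDatumLocalCongr L v Tv hav hv).symm
      (IrrClass.comap (cmSplitEquiv L H' hH' hH'd v w hw)
        (IrrClass.mk (splitMemberGL (w.1.adicCompletion L) ν₀ χ' hν₀u hν₀c hχ'u hχ'c))) =
    IrrClass.comap (cmSplitEquiv L H₀ hH₀ hH₀d v w hw)
      (IrrClass.mk (splitMemberGL (w.1.adicCompletion L) ν₀ χ' hν₀u hν₀c hχ'u hχ'c))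
  rw [IrrClass.comap_comap]
  refine (IrrClass.comap_eq_comap_of_forall_eq_conj _ _ (localGLPiEquiv L 3 v Tv w)⁻¹ (fun g => ?_) _).symm
  change localGLPiEquiv L 3 v (Tv⁻¹ * g.val * Tv) w =
    (localGLPiEquiv L 3 v Tv w)⁻¹ * localGLPiEquiv L 3 v g.val w * (localGLPiEquiv L 3 v Tv w)⁻¹⁻¹
  rw [map_mul, map_mul, map_inv, inv_inv]
  rfl

end Packets

/-! ## §3 The ξ-envelope rides: `LocalConstituentsIn`, `IsXiLocalFamily`, `MemXiFamily` -/

section Envelope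

variable {L : Type} [Field L] [NumberField L] [IsCMField L] {H₀ H' : Matrix (Fin 3) (Fin 3) L}
  {μ₀ : Measure (adelicGroupData (↥(maximalRealSubfield L)) L (IsCMField.complexConj L) 3 H₀).automorphicQuotient}
  [(adelicGroupData (↥(maximalRealSubfield L)) L (IsCMField.complexConj L) 3 H₀).IsAutomorphicMeasure μ₀]
  {μ' : Measure (adelicGroupData (↥(maximalRealSubfield L)) L (IsCMField.complexConj L) 3 H').automorphicQuotient}
  [(adelicGroupData (↥(maximalRealSubfield L)) L (IsCMField.complexConj L) 3 H').IsAutomorphicMeasure μ']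
  {P₀ : DiscreteAutomorphicRep (adelicGroupData (↥(maximalRealSubfield L)) L (IsCMField.complexConj L) 3 H₀) μ₀}
  {P' : DiscreteAutomorphicRep (adelicGroupData (↥(maximalRealSubfield L)) L (IsCMField.complexConj L) 3 H') μ'}

/-- **`LocalConstituentsIn` rides ANY identifications `e_v : U(H′)_v ≃ₜ* U(H₀)_v`** under the local-constituent correspondence `hloc` («every `v`-constituent `c` of
`P₀` has `comap e_v c` a `v`-constituent of `P′`», constituents read in the (b2′) smooth-part currency of D6 through ★ `localPiEquiv` ∕ ★ `inclPlace`): a family `Pv`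
serving `P′` serves `P₀` after transport `v ↦ (Pv v).map (comap e_v⁻¹)` (★ `LocalAPacket.members_map`, ★ `IrrClass.comap_symm_comap`).  «`π = ⊗ π_v` with
`π_v ∈ Π_v` for all `v`», read on either group. [cite: Rogawski1990, §13.3 p. 201; §14.2 p. 234] [cite: BushnellHenniart2006, §1.1] -/
theorem localConstituentsIn_map_comap_symm
    (e : ∀ v : HeightOneSpectrum (𝓞 ↥(maximalRealSubfield L)), (cmDatum L 3 H').Local v ≃ₜ* (cmDatum L 3 H₀).Local v)
    (hloc : ∀ (v : HeightOneSpectrum (𝓞 ↥(maximalRealSubfield L))) (c : IrrClass ((cmDatum L 3 H₀).Local v)),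
      (IrrClass.comap (localPiEquiv L (IsCMField.complexConj L) 3 H₀ v) c).IsConstituentOf
          (P₀.finRep.smoothPart.toRepresentation.comp
            (inclPlace (↥(maximalRealSubfield L)) L (IsCMField.complexConj L) 3 H₀ v)) →
        (IrrClass.comap (localPiEquiv L (IsCMField.complexConj L) 3 H' v) (IrrClass.comap (e v) c)).IsConstituentOf
          (P'.finRep.smoothPart.toRepresentation.comp
            (inclPlace (↥(maximalRealSubfield L)) L (IsCMField.complexConj L) 3 H' v)))
    {Pv : ∀ v : HeightOneSpectrum (𝓞 ↥(maximalRealSubfield L)), CMLocalAPacket L H' v}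
    (hP' : LocalConstituentsIn P' Pv) :
    LocalConstituentsIn P₀ fun v => (Pv v).map (IrrClass.comap (e v).symm) := by
  intro v c hc
  rw [LocalAPacket.members_map]
  exact ⟨IrrClass.comap (e v) c, hP' v _ (hloc v c hc), IrrClass.comap_symm_comap _ _⟩

/-- **A ξ-local family rides form congruences.**  If `Pv` is a ξ-local family for `U(H′)` (★ `OneDimAutRepH.IsXiLocalFamily`, relative to `μ = μω`) and
`e_v = cmDatumLocalCongr L v T_v _ _ : U(H′)_v ≃ₜ* U(H₀)_v` are local form congruences (`ᵗT̄_v (H₀)_v T_v = a_v • (H′)_v`), then `v ↦ (Pv v).map (comap e_v⁻¹)` is a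
ξ-local family for `U(H₀)`: at a split `v` the split packet at the FIXED witness `w = splitWitness v hs` goes to the split packet (§2); at a non-split `v` the
identification `e_T : U(Φ₃)_v ≃ U(H′)_v` of the family becomes `e_v ∘ e_T = e_{T_vT}` — again a form congruence, multiplier `a_v a` (§1
`formCongr_mul_eq_mul_smul_of_formCongr_eq_smul`, `comap_symm_comap_symm_cmDatumLocalCongr`) — with THE SAME constituent `x` of `i_G(χ_ξ)` on `U(Φ₃)(L⁺_v)` (so Keys
labels ∕ square-integrability data are untouched), and the optional supercuspidal member stays supercuspidal (★ `IrrClass.IsSupercuspidal.comap`).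
[cite: Rogawski1990, §14.2 pp. 232–234; §13.1 p. 199; §4.13 p. 62] [cite: PlatonovRapinchuk1994, §2.3] -/
theorem isXiLocalFamily_map_comap_cmDatumLocalCongr_symm
    (hH₀ : (H₀.map (cmConjRingHom L))ᵀ = H₀) (hH₀d : IsUnit H₀.det)
    (hH' : (H'.map (cmConjRingHom L))ᵀ = H') (hH'd : IsUnit H'.det)
    (Tv : ∀ v : HeightOneSpectrum (𝓞 ↥(maximalRealSubfield L)), GL (Fin 3) (LocalRing L v))
    (av : ∀ v : HeightOneSpectrum (𝓞 ↥(maximalRealSubfield L)), LocalRing L v) (hav : ∀ v, IsUnit (av v))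
    (hv : ∀ v : HeightOneSpectrum (𝓞 ↥(maximalRealSubfield L)),
      formCongr (conjLocal L (IsCMField.complexConj L) v) (Tv v) (H₀.map (algebraMap L (LocalRing L v))) =
        av v • H'.map (algebraMap L (LocalRing L v)))
    {ξ : OneDimAutRepH L} {μω : HeckeCharacter L} {hμu : μω.IsUnitary}
    {Pv : ∀ v : HeightOneSpectrum (𝓞 ↥(maximalRealSubfield L)), CMLocalAPacket L H' v}
    (h : ξ.IsXiLocalFamily hH' hH'd μω hμu Pv) :
    ξ.IsXiLocalFamily hH₀ hH₀d μω hμu fun v =>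
      (Pv v).map (IrrClass.comap (cmDatumLocalCongr L v (Tv v) (hav v) (hv v)).symm) := by
  refine ⟨fun v hs => ?_, fun v hns => ?_⟩
  · change (Pv v).map _ = _
    rw [h.1 v hs]
    exact cmSplitPacket_map_comap_cmDatumLocalCongr_symm L hH₀ hH₀d hH' hH'd v (Tv v) (hav v) (hv v) _ _ _ _ _ _ _ _
  · obtain ⟨T, a, ha, hT, x, s, hPv, hx, hs⟩ := h.2 v hns
    refine ⟨Tv v * T, av v * a, (hav v).mul ha,
      formCongr_mul_eq_mul_smul_of_formCongr_eq_smul L v T (Tv v) hT (hv v), x,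
      s.map (IrrClass.comap (cmDatumLocalCongr L v (Tv v) (hav v) (hv v)).symm), ?_, hx, ?_⟩
    · change (Pv v).map _ = _
      rw [hPv]
      exact LocalAPacket.ext' (comap_symm_comap_symm_cmDatumLocalCongr L v T (Tv v) ha (hav v) _ hT (hv v) _ x) rfl
    · intro c hc
      obtain ⟨c', hc', rfl⟩ := Option.map_eq_some_iff.1 hc
      exact (hs c' hc').comap _

/-- **(B3b) `MemXiFamily` RIDES THE CONGRUENCE** (FILE B's ED. 2 sub-socket `sock_S9_congrMemXiFamily`, with its one input NAMED).  For hermitian `H₀, H′ ∈ M₃(L)`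
with unit determinants, local form congruences `e_v : U(H′)(L⁺_v) ≃ₜ* U(H₀)(L⁺_v)` (`ᵗT̄_v (H₀)_v T_v = a_v • (H′)_v`) at every finite `v`, and discrete automorphic
`P′` of `U(H′)`, `P₀` of `U(H₀)` whose local constituents correspond along `e_v` (`hloc`: every `v`-constituent `c` of `P₀` has `comap e_v c` a `v`-constituent of
`P′` — what the (B3a) transport `P′ ↦ P₀ = P′ ∘ Ad(Q_𝔸)⁻¹` along ★ `adelicUnitaryGroupCongr` delivers, ★ `toLocal_adelicUnitaryGroupCongr`; or §4 from a local
equivalence): `MemXiFamily P′ hH′ hH′d μω hμu ξ → MemXiFamily P₀ hH₀ hH₀d μω hμu ξ` — the transported family (`isXiLocalFamily_map_comap_cmDatumLocalCongr_symm`)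
contains every local constituent of `P₀` (`localConstituentsIn_map_comap_symm`).  «We fix an isomorphism `ψ : G′ → G` … `Π′(ξ) = ⊗ Π′(ξ_v)`, `Π′(ξ_v) = Π(ξ_v)` for
finite `v`.» [cite: Rogawski1990, §14.2 pp. 232–234; §14.6 p. 246; §13.1 p. 199] [cite: PlatonovRapinchuk1994, §2.3] -/
theorem memXiFamily_of_localCongr
    (hH₀ : (H₀.map (cmConjRingHom L))ᵀ = H₀) (hH₀d : IsUnit H₀.det)
    (hH' : (H'.map (cmConjRingHom L))ᵀ = H') (hH'd : IsUnit H'.det)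
    (Tv : ∀ v : HeightOneSpectrum (𝓞 ↥(maximalRealSubfield L)), GL (Fin 3) (LocalRing L v))
    (av : ∀ v : HeightOneSpectrum (𝓞 ↥(maximalRealSubfield L)), LocalRing L v) (hav : ∀ v, IsUnit (av v))
    (hv : ∀ v : HeightOneSpectrum (𝓞 ↥(maximalRealSubfield L)),
      formCongr (conjLocal L (IsCMField.complexConj L) v) (Tv v) (H₀.map (algebraMap L (LocalRing L v))) =
        av v • H'.map (algebraMap L (LocalRing L v)))
    (hloc : ∀ (v : HeightOneSpectrum (𝓞 ↥(maximalRealSubfield L))) (c : IrrClass ((cmDatum L 3 H₀).Local v)),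
      (IrrClass.comap (localPiEquiv L (IsCMField.complexConj L) 3 H₀ v) c).IsConstituentOf
          (P₀.finRep.smoothPart.toRepresentation.comp
            (inclPlace (↥(maximalRealSubfield L)) L (IsCMField.complexConj L) 3 H₀ v)) →
        (IrrClass.comap (localPiEquiv L (IsCMField.complexConj L) 3 H' v)
            (IrrClass.comap (cmDatumLocalCongr L v (Tv v) (hav v) (hv v)) c)).IsConstituentOf
          (P'.finRep.smoothPart.toRepresentation.comp
            (inclPlace (↥(maximalRealSubfield L)) L (IsCMField.complexConj L) 3 H' v)))
    {μω : HeckeCharacter L} {hμu : μω.IsUnitary} {ξ : OneDimAutRepH L}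
    (hmem : MemXiFamily P' hH' hH'd μω hμu ξ) : MemXiFamily P₀ hH₀ hH₀d μω hμu ξ := by
  obtain ⟨Pv, hPv, hP⟩ := hmem
  exact ⟨_, isXiLocalFamily_map_comap_cmDatumLocalCongr_symm hH₀ hH₀d hH' hH'd Tv av hav hv hPv,
    localConstituentsIn_map_comap_symm (fun v => cmDatumLocalCongr L v (Tv v) (hav v) (hv v)) hloc hP⟩

/-! ## §4 The junction with (B3a): `hloc` (as an iff) from a local equivalence of representations -/

/-- **Local-constituent correspondence from a local EQUIVALENCE.**  If at every finite `v` the local representation of `P₀`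
(`P₀|_{U(H₀)(𝔸_f)}^{sm} ∘ inclPlace v` on ★ `localPi … H₀ v`) is equivalent (Mathlib-currency ★ `Representation.Equiv`) to the local representation of `P′` pulled
back along `ψ_v := localPiEquiv_{H₀} ≫ e_v⁻¹ ≫ localPiEquiv_{H′}⁻¹ : localPi … H₀ v ≃ₜ* localPi … H′ v` — the shape in which a transport `P₀ = P′ ∘ Φ⁻¹` of
representation SPACES along an adelic isomorphism `Φ` with `v`-components `e_v` presents itself — then for every class `c` of `U(H₀)(L⁺_v)`:
`comap (localPiEquiv_{H₀}) c` is a `v`-constituent of `P₀` IFF `comap (localPiEquiv_{H′}) (comap e_v c)` is a `v`-constituent of `P′` (★ `isConstituentOf_congr`, ★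
`comap_isConstituentOf_comp_iff`, functoriality ★ `comap_comap`; `ψ_v ≫ localPiEquiv_{H′} ≫ e_v = localPiEquiv_{H₀}` pointwise).  Both directions are what (B3)
consumes: (⇒) feeds `memXiFamily_of_localCongr`, (⇐) carries a constituent of `P′` to one of `P₀` so that (B0) at `H₀` applies to it.
[cite: Rogawski1990, §14.2 pp. 232–234; §13.1 p. 199] [cite: BushnellHenniart2006, §1.1] -/
theorem comap_isConstituentOf_iff_of_localEquiv
    (e : ∀ v : HeightOneSpectrum (𝓞 ↥(maximalRealSubfield L)), (cmDatum L 3 H').Local v ≃ₜ* (cmDatum L 3 H₀).Local v)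
    (φ : ∀ v : HeightOneSpectrum (𝓞 ↥(maximalRealSubfield L)),
      Representation.Equiv
        (P₀.finRep.smoothPart.toRepresentation.comp
          (inclPlace (↥(maximalRealSubfield L)) L (IsCMField.complexConj L) 3 H₀ v))
        ((P'.finRep.smoothPart.toRepresentation.comp
          (inclPlace (↥(maximalRealSubfield L)) L (IsCMField.complexConj L) 3 H' v)).comp
          (((localPiEquiv L (IsCMField.complexConj L) 3 H₀ v).trans
              ((e v).symm.trans (localPiEquiv L (IsCMField.complexConj L) 3 H' v).symm) :
              localPi L (IsCMField.complexConj L) 3 H₀ v ≃ₜ* localPi L (IsCMField.complexConj L) 3 H' v) :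
            localPi L (IsCMField.complexConj L) 3 H₀ v →* localPi L (IsCMField.complexConj L) 3 H' v)))
    (v : HeightOneSpectrum (𝓞 ↥(maximalRealSubfield L))) (c : IrrClass ((cmDatum L 3 H₀).Local v)) :
    (IrrClass.comap (localPiEquiv L (IsCMField.complexConj L) 3 H₀ v) c).IsConstituentOf
        (P₀.finRep.smoothPart.toRepresentation.comp
          (inclPlace (↥(maximalRealSubfield L)) L (IsCMField.complexConj L) 3 H₀ v)) ↔
      (IrrClass.comap (localPiEquiv L (IsCMField.complexConj L) 3 H' v) (IrrClass.comap (e v) c)).IsConstituentOf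
        (P'.finRep.smoothPart.toRepresentation.comp
          (inclPlace (↥(maximalRealSubfield L)) L (IsCMField.complexConj L) 3 H' v)) := by
  have key : ∀ g : ↥(localPi L (IsCMField.complexConj L) 3 H₀ v),
      (e v) ((localPiEquiv L (IsCMField.complexConj L) 3 H' v)
        ((localPiEquiv L (IsCMField.complexConj L) 3 H' v).symm
          ((e v).symm ((localPiEquiv L (IsCMField.complexConj L) 3 H₀ v) g)))) =
        (localPiEquiv L (IsCMField.complexConj L) 3 H₀ v) g := by
    intro g
    rw [ContinuousMulEquiv.apply_symm_apply, ContinuousMulEquiv.apply_symm_apply]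
  have key' : IrrClass.comap ((localPiEquiv L (IsCMField.complexConj L) 3 H₀ v).trans
          ((e v).symm.trans (localPiEquiv L (IsCMField.complexConj L) 3 H' v).symm))
        (IrrClass.comap (localPiEquiv L (IsCMField.complexConj L) 3 H' v) (IrrClass.comap (e v) c)) =
      IrrClass.comap (localPiEquiv L (IsCMField.complexConj L) 3 H₀ v) c := by
    rw [IrrClass.comap_comap, IrrClass.comap_comap]
    exact (IrrClass.comap_eq_comap_of_forall_eq_conj _ _ 1 (fun g => by rw [one_mul, inv_one, mul_one]; exact key g) c).symm
  refine (IrrClass.isConstituentOf_congr (φ v) _).trans ?_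
  refine (iff_of_eq (congrArg (fun d => IrrClass.IsConstituentOf d _) key'.symm)).trans ?_
  exact IrrClass.comap_isConstituentOf_comp_iff _ _ _

end Envelope

end Summit.HodgeConjecture.HodgeConjecture.R90.S9

end
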